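import Mathlib
import Summits.Ventures.PercRepro2.TB14Series

/-!
# The mark slides along a degree-two vertex at the opposite root (typed BHK 1.4)
(blind cell PercRepro2, mine-c g17, 2026-08-25; `proofs/MINEC-TB14BLOCK.md` Theorem K)

Let the mark `b` have exactly two edges `e₁ = b x` and `e₂ = b a₂` (to the OTHER root), both free.
In the folded kernel `foldK = 1_Q(y) 1_Q(w) 1[b ∈ C_y(a₁)] (1[o ∈ C_w(a₂)] − 1[o ∈ C_y(a₂)])` the
mark `b` lives in the first copy `y`.  Of the four colourings of `(e₁, e₂)` only «`e₁` open, `e₂`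
closed in `y`» contributes: with `e₂` open in `y` the connection `a₁ ↔ b` would give `a₁ ↔ a₂`
(so `1_Q(y) = 0` or `1[b ∈ C_y(a₁)] = 0`), and with both closed `b` is isolated in `y`.  In the
contributing colouring `b` is a leaf of both copies (at `x` in `y`, at `a₂` in `w`), so every
connection off `b` is that of the configuration with both edges closed, and `a₁ ↔ b` in `y` is
`a₁ ↔ x` there.  Hence (`pairCount_foldK_slide`)

  `D(G; a₁, a₂, b, o) = D(G − b; a₁, a₂, x, o)`

at every profile in which `e₁, e₂` are free — the mark slides to its other neighbour.  Exact check
`data/mine-c/g17/scripts/slide.py` (7,250 / 7,250 instances on 8-vertex graphs).  Own work;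
standard axioms.
-/

namespace Summit.Ventures.PercRepro2

namespace TB14Cut

open CovForm A3InactiveTyped

section Slide

variable {V : Type} {E : Type} [Fintype E] [DecidableEq E] {R : Type*} [Field R]
variable {ends : E → Sym2 V} {e₁ e₂ : E} {b x a₁ a₂ o : V}

omit [Fintype E] [DecidableEq E] in
/-- The folded kernel vanishes when the first copy does not connect `a₁` to the mark. -/
lemma foldK_eq_zero_of_not_conn {y w : Config E} (h : ¬ Conn ends y a₁ b) :
    (foldK ends a₁ a₂ b o y w : R) = 0 := by
  classical
  simp [foldK, iL_eq_ite', h]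

omit [Fintype E] [DecidableEq E] in
/-- The folded kernel vanishes when the first copy connects the two roots. -/
lemma foldK_eq_zero_of_conn_roots {y w : Config E} (h : Conn ends y a₁ a₂) :
    (foldK ends a₁ a₂ b o y w : R) = 0 := by
  classical
  simp [foldK, iQ_eq_ite', h]

omit [Fintype E] [DecidableEq E] in
/-- The folded kernel vanishes when an edge `b a₂` is open in the first copy. -/
lemma foldK_eq_zero_of_open_root_edge {y w : Config E} (h₂ : ends e₂ = s(b, a₂))
    (hy : y e₂ = true) : (foldK ends a₁ a₂ b o y w : R) = 0 := by
  classical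
  by_cases hc : Conn ends y a₁ b
  · exact foldK_eq_zero_of_conn_roots (conn_trans hc (conn_of_openAdj ⟨e₂, hy, h₂⟩))
  · exact foldK_eq_zero_of_not_conn hc

omit [Fintype E] [DecidableEq E] in
/-- The folded kernel with the mark `b` replaced by `x`: when all connections off `b` agree in the
two copies and `a₁ ↔ b` in `y` is `a₁ ↔ x` in `y'`. -/
lemma foldK_congr_mark {y y' w w' : Config E} (ha₁ : a₁ ≠ b) (ha₂ : a₂ ≠ b) (ho : o ≠ b)
    (h1 : ∀ t t' : V, t ≠ b → t' ≠ b → (Conn ends y t t' ↔ Conn ends y' t t'))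
    (h2 : ∀ t t' : V, t ≠ b → t' ≠ b → (Conn ends w t t' ↔ Conn ends w' t t'))
    (hbx : Conn ends y a₁ b ↔ Conn ends y' a₁ x) :
    (foldK ends a₁ a₂ b o y w : R) = foldK ends a₁ a₂ x o y' w' := by
  classical
  simp only [foldK, iQ_eq_ite', iL_eq_ite', iH_eq_ite', h1 a₁ a₂ ha₁ ha₂, hbx, h1 a₂ o ha₂ ho,
    h2 a₁ a₂ ha₁ ha₂, h2 a₂ o ha₂ ho]

omit [Fintype E] in
/-- If `e₁ = b x` is the only open edge at `b`, then `a₁ ↔ b` iff `a₁ ↔ x` after closing `e₁`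
(for `a₁ ≠ b`). -/
lemma conn_mark_leaf {y : Config E} (h₁ : ends e₁ = s(b, x)) (hbx : b ≠ x)
    (hb : ∀ f, b ∈ ends f → f ≠ e₁ → y f = false) (hy : y e₁ = true) (ha₁ : a₁ ≠ b) :
    Conn ends y a₁ b ↔ Conn ends (Function.update y e₁ false) a₁ x := by
  have hadj : Conn ends y b x := conn_of_openAdj ⟨e₁, hy, h₁⟩
  rw [← conn_leaf_erase h₁ hbx hb hy ha₁ hbx.symm]
  exact ⟨fun h => conn_trans h hadj, fun h => conn_trans h (conn_symm hadj)⟩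

/-- **The mark slides along a degree-two vertex at the opposite root** (THEOREM K): if the mark
`b` has exactly the two free edges `e₁ = b x` and `e₂ = b a₂`, then the two-copy count of the
folded kernel equals the count with both edges closed and the mark moved to `x`:
`D(G; a₁, a₂, b, o) = D(G − b; a₁, a₂, x, o)`. -/
theorem pairCount_foldK_slide (he : e₁ ≠ e₂) (h₁ : ends e₁ = s(b, x)) (h₂ : ends e₂ = s(b, a₂))
    (hbx : b ≠ x) (hba₂ : b ≠ a₂) (hb : ∀ f, b ∈ ends f → f = e₁ ∨ f = e₂)
    (ha₁ : a₁ ≠ b) (ho : o ≠ b) (F : Finset E) (z : Config E) (h₁F : e₁ ∈ F) (h₂F : e₂ ∈ F) :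
    pairCount F z (foldK ends a₁ a₂ b o : Config E → Config E → R) =
      pairCount ((F.erase e₂).erase e₁) (Function.update (Function.update z e₂ false) e₁ false)
        (foldK ends a₁ a₂ x o) := by
  classical
  set F' := F.erase e₂ with hF'
  set z' := Function.update z e₂ false with hz'
  set F'' := F'.erase e₁ with hF''
  set z'' := Function.update z' e₁ false with hz''
  have h₁F' : e₁ ∈ F' := Finset.mem_erase.2 ⟨he, h₁F⟩
  have hb₁ : ∀ f, b ∈ ends f → f ≠ e₁ → f = e₂ := fun f hf hf₁ => (hb f hf).resolve_left hf₁
  have hb₂ : ∀ f, b ∈ ends f → f ≠ e₂ → f = e₁ := fun f hf hf₂ => (hb f hf).resolve_right hf₂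
  have he₁ : b ∈ ends e₁ := by rw [h₁]; exact Sym2.mem_mk_left _ _
  have he₂ : b ∈ ends e₂ := by rw [h₂]; exact Sym2.mem_mk_left _ _
  -- the contributing colouring: `e₁` open and `e₂` closed in the first copy
  have hmain : ∀ y₂ : Config E, y₂ e₁ = false → y₂ e₂ = false →
      (foldK ends a₁ a₂ b o (Function.update y₂ e₁ true)
          (A3InactiveTyped.flipOn F (Function.update y₂ e₁ true)) : R) =
        foldK ends a₁ a₂ x o y₂ (A3InactiveTyped.flipOn F'' y₂) := by
    intro y₂ hy₂₁ hy₂₂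
    set y := Function.update y₂ e₁ true with hy
    set w := A3InactiveTyped.flipOn F y with hw
    have hy₁ : y e₁ = true := Function.update_self _ _ _
    have hy₂ : y e₂ = false := by rw [hy, Function.update_of_ne he.symm]; exact hy₂₂
    have hyback : Function.update y e₁ false = y₂ := by
      rw [hy, Function.update_idem, ← hy₂₁]; exact Function.update_eq_self e₁ y₂
    have hleafy : ∀ f, b ∈ ends f → f ≠ e₁ → y f = false := by
      intro f hf hf₁
      rw [hb₁ f hf hf₁]; exact hy₂
    have hw₁ : w e₁ = false := by
      rw [hw, A3InactiveTyped.flipOn_of_mem h₁F, hy₁]; rfl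
    have hw₂ : w e₂ = true := by
      rw [hw, A3InactiveTyped.flipOn_of_mem h₂F, hy₂]; rfl
    have hleafw : ∀ f, b ∈ ends f → f ≠ e₂ → w f = false := by
      intro f hf hf₂
      rw [hb₂ f hf hf₂]; exact hw₁
    have hwback : Function.update w e₂ false = A3InactiveTyped.flipOn F'' y₂ := by
      funext f
      by_cases hf₂ : f = e₂
      · subst hf₂
        rw [Function.update_self,
          A3InactiveTyped.flipOn_of_notMem (fun h => Finset.notMem_erase f F
            (Finset.mem_of_mem_erase h))]
        exact hy₂₂.symm
      by_cases hf₁ : f = e₁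
      · subst hf₁
        rw [Function.update_of_ne hf₂, hw₁,
          A3InactiveTyped.flipOn_of_notMem (Finset.notMem_erase f F')]
        exact hy₂₁.symm
      · rw [Function.update_of_ne hf₂, hw]
        by_cases hfF : f ∈ F
        · rw [A3InactiveTyped.flipOn_of_mem hfF,
            A3InactiveTyped.flipOn_of_mem (Finset.mem_erase.2 ⟨hf₁, Finset.mem_erase.2 ⟨hf₂, hfF⟩⟩),
            hy, Function.update_of_ne hf₁]
        · rw [A3InactiveTyped.flipOn_of_notMem hfF,
            A3InactiveTyped.flipOn_of_notMem (fun h => hfF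
              (Finset.mem_of_mem_erase (Finset.mem_of_mem_erase h))), hy,
            Function.update_of_ne hf₁]
    refine foldK_congr_mark ha₁ hba₂.symm ho ?_ ?_ ?_
    · intro t t' ht ht'
      rw [conn_leaf_erase h₁ hbx hleafy hy₁ ht ht', hyback]
    · intro t t' ht ht'
      rw [conn_leaf_erase h₂ hba₂ hleafw hw₂ ht ht', hwback]
    · rw [conn_mark_leaf h₁ hbx hleafy hy₁ ha₁, hyback]
  -- the counting: split on `e₂`, then on `e₁`
  unfold pairCount
  rw [sum_admissible_split h₂F, ← hF', ← hz', sum_admissible_split h₁F', ← hF'', ← hz'']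
  refine Finset.sum_congr rfl fun y₂ _ => ?_
  by_cases hadm : ∀ f, f ∉ F'' → y₂ f = z'' f
  · rw [if_pos hadm, if_pos hadm]
    have hy₂₁ : y₂ e₁ = false := by
      have := hadm e₁ (Finset.notMem_erase e₁ F')
      rwa [hz'', Function.update_self] at this
    have hy₂₂ : y₂ e₂ = false := by
      have := hadm e₂ (fun h => Finset.notMem_erase e₂ F (Finset.mem_of_mem_erase h))
      rwa [hz'', Function.update_of_ne he.symm, hz', Function.update_self] at this
    -- `e₁` closed: `update y₂ e₁ false = y₂`
    have hself₁ : Function.update y₂ e₁ false = y₂ := by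
      rw [← hy₂₁]; exact Function.update_eq_self e₁ y₂
    have hself₂ : Function.update y₂ e₂ false = y₂ := by
      rw [← hy₂₂]; exact Function.update_eq_self e₂ y₂
    have hself₂' : Function.update (Function.update y₂ e₁ true) e₂ false =
        Function.update y₂ e₁ true := by
      have : Function.update y₂ e₁ true e₂ = false := by
        rw [Function.update_of_ne he.symm]; exact hy₂₂
      rw [← this]; exact Function.update_eq_self e₂ _
    rw [hself₁, hself₂, hself₂']
    -- the three vanishing colourings
    have hA : (foldK ends a₁ a₂ b o y₂ (A3InactiveTyped.flipOn F y₂) : R) = 0 := by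
      refine foldK_eq_zero_of_not_conn (not_conn_isolated ?_ ha₁)
      intro f hf
      rcases hb f hf with rfl | rfl
      · exact hy₂₁
      · exact hy₂₂
    have hB : (foldK ends a₁ a₂ b o (Function.update y₂ e₂ true)
        (A3InactiveTyped.flipOn F (Function.update y₂ e₂ true)) : R) = 0 :=
      foldK_eq_zero_of_open_root_edge h₂ (Function.update_self _ _ _)
    have hD : (foldK ends a₁ a₂ b o (Function.update (Function.update y₂ e₁ true) e₂ true)
        (A3InactiveTyped.flipOn F (Function.update (Function.update y₂ e₁ true) e₂ true)) : R) =
        0 :=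
      foldK_eq_zero_of_open_root_edge h₂ (Function.update_self _ _ _)
    rw [hA, hB, hD, hmain y₂ hy₂₁ hy₂₂]
    ring
  · rw [if_neg hadm, if_neg hadm]

end Slide

end TB14Cut

end Summit.Ventures.PercRepro2
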